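import Mathlib.Analysis.Calculus.ParametricIntervalIntegral
import Mathlib.Analysis.Calculus.Deriv.MeanValue
import Mathlib.Analysis.Calculus.Gradient.Basic
import Mathlib.Analysis.InnerProductSpace.Calculus
import Mathlib.MeasureTheory.Integral.IntervalIntegral.FundThmCalculus
import Mathlib.MeasureTheory.Integral.DominatedConvergence
import Literature.Analysis.FluidPDE.NSVorticity
import Literature.Analysis.FluidPDE.SpaceTimeCalculus
import HarnessLib

/-!
# Kelvin's circulation theorem: discharge of `kelvin_circulation_theorem` (**ns.S34**) and of
# `IsClassicalEulerSolutionOn.circulation_eq`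

Trunk: FluidKinetic (`Literature/Analysis/FluidPDE`). The named facts
`Literature.Analysis.FluidPDE.IsClassicalEulerSolutionOn.circulation_eq` (`Vorticity.lean`) and its
restatement `Literature.Analysis.FluidPDE.kelvin_circulation_theorem` (`NSVorticity.lean`) —
Majda–Bertozzi, *Vorticity and Incompressible Flow* (CUP 2002), §1.6, **Prop. 1.11** (Kelvin's
conservation of circulation: for a smooth solution of the Euler equation the circulation
`Γ_{C(t)} = ∮_{C(t)} v · dℓ` (1.59) around a closed curve `C(t)` moving with the fluid is constant
in time), obtained there from the transport formula for material curves **Prop. 1.10**, eq. (1.58)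
(`d/dt ∮_{C(t)} v·dℓ = ∮_{C(t)} Dv/Dt · dℓ`, "proof left as an exercise"), the Euler equation
`Dv/Dt = −∇p` (1.62) and `∮_{C(t)} ∇p · dℓ = 0` — are now theorems:
`IsClassicalEulerSolutionOn.circulation_eq_holds` and `kelvin_circulation_theorem_holds`.

## Statement (as vendored)

`E` a finite-dimensional real inner product space, `(u, p)` a classical unforced Euler solution
on the time set `S` (`IsClassicalEulerSolutionOn S 0 u p`: `u`, `p` jointly `C^∞` on `S × E`,
`∂ₜu + (u·∇)u = −∇p` with the one-sided time derivative within `S`, `div u = 0`), `S` convex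
(an interval), `X : ℝ → E → E` jointly smooth on `S × E` with `∂ₜX(t, a) = u(t, X(t, a))` within
`S`, `γ : ℝ → E` a `C¹` loop (`γ 0 = γ 1`). Then for `t₀, t₁ ∈ S`,
`circulation (u t₁) (X t₁ ∘ γ) = circulation (u t₀) (X t₀ ∘ γ)`, where
`circulation v c = ∫₀¹ ⟪v (c s), c′(s)⟫ ds`.

## Proof

Write `Γ(t) = ∫₀¹ F(t, s) ds`, `F(t, s) = ⟪u(t, Y), ∂ₛY⟫`, `Y = X(t, γ(s))`,
`∂ₛY = D(X t)(γ s) γ′(s)` (chain rule; this is the integrand of `circulation (u t) (X t ∘ γ)` for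
`t ∈ S`).

1. *Reduction to a compact slab.* For `t₀ < t₁` in `S`, `[t₀, t₁] ⊆ S` (convexity) and all data
   restrict to `Icc t₀ t₁` (`IsClassicalNSSolutionOn.mono`, `uniqueDiffOn_Icc`); the case
   `t₁ < t₀` is symmetric and `t₀ = t₁` is trivial. So let `S = [a, b]`, `a < b`.
2. *Continuity of `Γ` on `[a, b]`.* `F` is jointly continuous on `[a, b] × ℝ` (joint continuity
   of `u`, `X` and of the slice derivative field `(t, x) ↦ D(X t)(x)` up to the boundary,
   `IsSmoothSpaceTimeOn.fderiv_slice`), hence `Γ` is continuous on `[a, b]`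
   (`intervalIntegral.continuous_parametric_intervalIntegral_of_continuous'` on the subtype).
3. *`Γ′ = 0` on `(a, b)`* (Majda–Bertozzi's computation (1.58) + (1.62)). At an interior time,
   differentiation under the integral sign
   (`intervalIntegral.hasDerivAt_integral_of_dominated_loc_of_deriv_le`, dominated by the maximum
   of the continuous `∂ₜF` on a compact time-neighbourhood × `[0, 1]`) gives
   `Γ′(t) = ∫₀¹ ∂ₜF(t, s) ds` with
   `∂ₜF = ⟪d/dt u(t, Y), ∂ₛY⟫ + ⟪u(t, Y), d/dt ∂ₛY⟫`, where
   `d/dt u(t, X(t, a)) = ∂ₜu + (u·∇)u = −∇p` at `X(t, a)` (chain rule along the trajectory and the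
   momentum equation; `IsClassicalEulerSolutionOn.hasDerivAt_velocity_comp_flow`) and
   `d/dt D(X t)(y) w = D(∂ₜX(t, ·))(y) w = D(u t ∘ X t)(y) w = D(u t)(Y) (D(X t)(y) w)` (Schwarz's
   theorem for the jointly smooth `X`, `IsSmoothSpaceTimeOn.hasDerivAt_fderiv_slice`, and
   `∂ₜX = u ∘ X`; `kelvin_hasDerivAt_fderiv_flow`). Hence
   `∂ₜF(t, s) = ⟪u(t,Y), D(u t)(Y) ∂ₛY⟫ − D(p t)(Y) ∂ₛY = d/ds [½‖u(t, X(t, γ s))‖² − p(t, X(t, γ s))]`,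
   whose integral over `[0, 1]` vanishes by the fundamental theorem of calculus because
   `γ 0 = γ 1` (`kelvin_integral_deriv_integrand_eq_zero`).
4. *Conclusion* by the mean value theorem (`exists_hasDerivAt_eq_slope`): `Γ b = Γ a`.

Only the velocity–trajectory relation `∂ₜX = u(t, X)` is used (no normalisation `X(t₀, ·) = id`,
no incompressibility), exactly as in Majda–Bertozzi's derivation.

## References

* A. J. Majda, A. L. Bertozzi, *Vorticity and Incompressible Flow*, Cambridge Texts in Applied
  Mathematics 27 (CUP 2002), doi:10.1017/cbo9780511613203 (`MajdaBertozziCUP2002`): §1.6,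
  Prop. 1.10, eq. (1.58) (transport formula for material curves), Prop. 1.11, eq. (1.59)
  (Kelvin's conservation of circulation), eq. (1.61) (viscous case, not used), §1.7 eq. (1.62).
-/

noncomputable section

open MeasureTheory Set Function Filter intervalIntegral
open _root_.Topology
open scoped ContDiff InnerProductSpace RealInnerProductSpace

namespace Literature.Analysis.FluidPDE

/-! ### A real-variable lemma: parametric interval integrals with vanishing interior derivative -/

section Parametric

/-- **Parametric interval integrals with vanishing derivative.** Let `F, F' : ℝ → ℝ → ℝ` be
jointly continuous on `[a, b] × ℝ`, `a < b`, with `∂_τ F(τ, s) = F'(τ, s)` for `τ ∈ (a, b)` and all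
`s`, and `∫₀¹ F'(t, s) ds = 0` for `t ∈ (a, b)`. Then `∫₀¹ F(b, s) ds = ∫₀¹ F(a, s) ds`.
(Continuity of `τ ↦ ∫₀¹ F(τ, s) ds` on `[a, b]` by
`intervalIntegral.continuous_parametric_intervalIntegral_of_continuous'`, differentiation under
the integral sign at interior times by
`intervalIntegral.hasDerivAt_integral_of_dominated_loc_of_deriv_le` with a constant bound on a
compact time-neighbourhood, and the mean value theorem `exists_hasDerivAt_eq_slope`.) [folklore] -/
theorem intervalIntegral_eq_of_hasDerivAt_of_integral_eq_zero {F F' : ℝ → ℝ → ℝ} {a b : ℝ}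
    (hab : a < b) (hF : ContinuousOn (uncurry F) (Icc a b ×ˢ univ))
    (hF' : ContinuousOn (uncurry F') (Icc a b ×ˢ univ))
    (hderiv : ∀ t ∈ Ioo a b, ∀ s, HasDerivAt (fun τ => F τ s) (F' t s) t)
    (hzero : ∀ t ∈ Ioo a b, IntervalIntegrable (F' t) volume 0 1 →
      ∫ s in (0 : ℝ)..1, F' t s = 0) :
    ∫ s in (0 : ℝ)..1, F b s = ∫ s in (0 : ℝ)..1, F a s := by
  -- slices of jointly continuous functions are continuous
  have hsl : ∀ {G : ℝ → ℝ → ℝ}, ContinuousOn (uncurry G) (Icc a b ×ˢ univ) →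
      ∀ t ∈ Icc a b, Continuous (G t) := by
    intro G hG t ht
    exact hG.comp_continuous (continuous_const.prodMk continuous_id) fun s => ⟨ht, mem_univ s⟩
  -- continuity of the parametric integral on `[a, b]` (through the subtype `Icc a b`)
  have hcont : ContinuousOn (fun τ => ∫ s in (0 : ℝ)..1, F τ s) (Icc a b) := by
    rw [continuousOn_iff_continuous_restrict]
    have hc : Continuous (uncurry fun (τ : Icc a b) (s : ℝ) => F τ s) :=
      hF.comp_continuous ((continuous_subtype_val.comp continuous_fst).prodMk continuous_snd)
        fun z => ⟨z.1.2, mem_univ _⟩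
    exact intervalIntegral.continuous_parametric_intervalIntegral_of_continuous' hc 0 1
  -- zero derivative at interior times
  have hd : ∀ t ∈ Ioo a b, HasDerivAt (fun τ => ∫ s in (0 : ℝ)..1, F τ s) 0 t := by
    intro t ht
    obtain ⟨ε, hε, hεsub⟩ :=
      Metric.nhds_basis_closedBall.mem_iff.1 (Ioo_mem_nhds ht.1 ht.2)
    have hK : IsCompact (Metric.closedBall t ε) := isCompact_closedBall t ε
    have hKS : Metric.closedBall t ε ⊆ Icc a b := hεsub.trans Ioo_subset_Icc_self
    obtain ⟨C, hC⟩ := (hK.prod (isCompact_Icc (a := (0 : ℝ)) (b := 1))).exists_bound_of_continuousOn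
      (hF'.mono (prod_mono hKS (subset_univ _)))
    have key := intervalIntegral.hasDerivAt_integral_of_dominated_loc_of_deriv_le
      (μ := volume) (a := (0 : ℝ)) (b := 1) (F := F) (F' := F') (x₀ := t) (bound := fun _ => C)
      (Metric.closedBall_mem_nhds t hε) ?_ ?_ ?_ ?_ ?_ ?_
    · have h2 := key.2
      rw [hzero t ht key.1] at h2
      exact h2
    · filter_upwards [Icc_mem_nhds ht.1 ht.2] with x hx using (hsl hF x hx).aestronglyMeasurable
    · exact (hsl hF t (Ioo_subset_Icc_self ht)).intervalIntegrable 0 1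
    · exact (hsl hF' t (Ioo_subset_Icc_self ht)).aestronglyMeasurable
    · refine ae_of_all _ fun s hs x hx => hC (x, s) ⟨hx, ?_⟩
      rw [uIoc_of_le (zero_le_one : (0 : ℝ) ≤ 1)] at hs
      exact Ioc_subset_Icc_self hs
    · exact intervalIntegrable_const
    · exact ae_of_all _ fun s _ x hx => hderiv x (hεsub hx) s
  -- mean value theorem
  obtain ⟨c, _, hc⟩ :=
    exists_hasDerivAt_eq_slope (fun τ => ∫ s in (0 : ℝ)..1, F τ s) (fun _ => (0 : ℝ)) hab hcont hd
  have h0 : ((∫ s in (0 : ℝ)..1, F b s) - ∫ s in (0 : ℝ)..1, F a s) / (b - a) = 0 := hc.symm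
  rw [div_eq_zero_iff, sub_eq_zero] at h0
  exact h0.resolve_right (sub_pos.2 hab).ne'

end Parametric

/-! ### The material derivative along particle trajectories -/

section Kelvin

variable {E : Type*} [NormedAddCommGroup E] [InnerProductSpace ℝ E] [FiniteDimensional ℝ E]
variable {S : Set ℝ} {u : ℝ → E → E} {p : ℝ → E → ℝ} {X : ℝ → E → E}

/-- **The Euler equation in joint-derivative form at an interior time.** For a classical unforced
Euler solution on `S` and `t` in the interior of `S`,
`D(uncurry u)(t, z)(1, u(t, z)) = ∂ₜu(t, z) + (u·∇)u(t, z) = −∇p(t, z)` (Majda–Bertozzi, eq. (1.62),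
`Dv/Dt = −∇p`; the one-sided time derivative within `S` is the two-sided one there). [cite: MajdaBertozziCUP2002, §1.7 eq. (1.62)] -/
theorem IsClassicalEulerSolutionOn.fderiv_uncurry_apply_one_velocity
    (h : IsClassicalEulerSolutionOn S 0 u p) {t : ℝ} (ht : S ∈ 𝓝 t) (z : E) :
    fderiv ℝ (uncurry u) (t, z) (1, u t z) = -gradient (p t) z := by
  have htS : t ∈ interior S := mem_interior_iff_mem_nhds.2 ht
  have hu : IsSmoothSpaceTimeOn (interior S) u := h.smooth_velocity.mono interior_subset
  have hm := h.momentum t (interior_subset htS) z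
  rw [timeDerivWithin_eq_deriv_of_mem_nhds ht, hu.deriv_timeLine isOpen_interior htS z,
    convect_apply, hu.fderiv_slice_apply_of_isOpen isOpen_interior htS z (u t z), ← map_add] at hm
  simpa using hm

/-- **Material derivative of the velocity along a particle trajectory.** If
`∂ₜX(t, a) = u(t, X(t, a))` within `S`, then at an interior time `t` of `S`,
`d/dt u(t, X(t, y)) = (∂ₜu + (u·∇)u)(t, X(t, y)) = −∇p(t, X(t, y))` (chain rule along the
trajectory and the Euler equation; Majda–Bertozzi, eqs. (1.13), (1.62)). [cite: MajdaBertozziCUP2002, §1.6–1.7, eqs. (1.13), (1.62)] -/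
theorem IsClassicalEulerSolutionOn.hasDerivAt_velocity_comp_flow
    (h : IsClassicalEulerSolutionOn S 0 u p)
    (hXu : ∀ t ∈ S, ∀ a, HasDerivWithinAt (fun s => X s a) (u t (X t a)) S t)
    {t : ℝ} (ht : S ∈ 𝓝 t) (y : E) :
    HasDerivAt (fun τ => u τ (X τ y)) (-gradient (p t) (X t y)) t := by
  have htS : t ∈ interior S := mem_interior_iff_mem_nhds.2 ht
  have hu : IsSmoothSpaceTimeOn (interior S) u := h.smooth_velocity.mono interior_subset
  have hc : HasDerivAt (fun τ : ℝ => (τ, X τ y)) ((1 : ℝ), u t (X t y)) t :=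
    (hasDerivAt_id' t).prodMk ((hXu t (interior_subset htS) y).hasDerivAt ht)
  have hU : HasFDerivAt (uncurry u) (fderiv ℝ (uncurry u) (t, X t y)) (t, X t y) :=
    ((hu.contDiffAt isOpen_interior htS (X t y)).differentiableAt (by simp)).hasFDerivAt
  have h2 := hU.comp_hasDerivAt t hc
  rw [h.fderiv_uncurry_apply_one_velocity ht] at h2
  exact h2

omit [FiniteDimensional ℝ E] in
/-- **Time derivative of the stretching factor** `D(X t)(y) w` of a material line element: if
`X` is jointly smooth on `S × E` with `∂ₜX(t, a) = u(t, X(t, a))` within `S` and `u` is jointly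
smooth, then at an interior time `t` of `S`,
`d/dt [D(X t)(y) w] = D(∂ₜX(t, ·))(y) w = D(u t)(X t y) (D(X t)(y) w)` (Schwarz's theorem for the
jointly smooth `X` exchanges `∂ₜ` and `D`; Majda–Bertozzi, proof of Lemma 1.4:
"differentiate `dX/dt = v(X, t)` with respect to `α`",
`d/dt ∇_α X = (∇v)|_{X} ∇_α X`). [cite: MajdaBertozziCUP2002, §1.6, proof of Lemma 1.4] -/
theorem kelvin_hasDerivAt_fderiv_flow (hu : IsSmoothSpaceTimeOn S u) (hX : IsSmoothSpaceTimeOn S X)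
    (hXu : ∀ t ∈ S, ∀ a, HasDerivWithinAt (fun s => X s a) (u t (X t a)) S t)
    {t : ℝ} (ht : S ∈ 𝓝 t) (y w : E) :
    HasDerivAt (fun τ => fderiv ℝ (X τ) y w) (fderiv ℝ (u t) (X t y) (fderiv ℝ (X t) y w)) t := by
  have htS : t ∈ interior S := mem_interior_iff_mem_nhds.2 ht
  have htS' : t ∈ S := interior_subset htS
  have hX' : IsSmoothSpaceTimeOn (interior S) X := hX.mono interior_subset
  have h1 := hX'.hasDerivAt_fderiv_slice isOpen_interior htS y w
  -- `∂ₜX(t, ·) = u t ∘ X t`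
  have heq : (fun y' => deriv (fun s => X s y') t) = u t ∘ X t := by
    funext y'
    exact ((hXu t htS' y').hasDerivAt ht).deriv
  rw [heq, fderiv_comp y ((hu.contDiff_slice htS').differentiable (by simp) _)
    ((hX.contDiff_slice htS').differentiable (by simp) _)] at h1
  exact h1

/-- **The time derivative of the circulation integrand** (Majda–Bertozzi, the computation behind
(1.58) and Prop. 1.11): at an interior time `t` of `S`, for fixed `y, w`,
`d/dt ⟪u(t, X(t, y)), D(X t)(y) w⟫ = ⟪u(t, Y), D(u t)(Y)(D(X t)(y) w)⟫ − D(p t)(Y)(D(X t)(y) w)`,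
`Y = X(t, y)` (product rule with `hasDerivAt_velocity_comp_flow` and
`kelvin_hasDerivAt_fderiv_flow`, `⟪−∇p, b⟫ = −Dp b`). [cite: MajdaBertozziCUP2002, §1.6 Prop. 1.10–1.11, eqs. (1.58)–(1.59)] -/
theorem IsClassicalEulerSolutionOn.hasDerivAt_circulation_integrand
    (h : IsClassicalEulerSolutionOn S 0 u p) (hX : IsSmoothSpaceTimeOn S X)
    (hXu : ∀ t ∈ S, ∀ a, HasDerivWithinAt (fun s => X s a) (u t (X t a)) S t)
    {t : ℝ} (ht : S ∈ 𝓝 t) (y w : E) :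
    HasDerivAt (fun τ => ⟪u τ (X τ y), fderiv ℝ (X τ) y w⟫)
      (⟪u t (X t y), fderiv ℝ (u t) (X t y) (fderiv ℝ (X t) y w)⟫
        - fderiv ℝ (p t) (X t y) (fderiv ℝ (X t) y w)) t := by
  have hG := h.hasDerivAt_velocity_comp_flow hXu ht y
  have hB := kelvin_hasDerivAt_fderiv_flow h.smooth_velocity hX hXu ht y w
  refine (hG.inner ℝ hB).congr_deriv ?_
  rw [inner_neg_left, inner_gradient_left]
  ring

omit [FiniteDimensional ℝ E] in
/-- **The loop integral of the time derivative vanishes.** For `t ∈ S` and a `C¹` loop `γ`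
(`γ 0 = γ 1`),
`∫₀¹ (⟪u(t,Y), D(u t)(Y) ∂ₛY⟫ − D(p t)(Y) ∂ₛY) ds = 0`, `Y = X(t, γ s)`, `∂ₛY = D(X t)(γ s) γ′(s)`:
the integrand is `d/ds [½ ‖u(t, X(t, γ s))‖² − p(t, X(t, γ s))]` and the endpoint values agree
(Majda–Bertozzi: "the line integral of the gradient is zero for closed curves"). [cite: MajdaBertozziCUP2002, §1.6, proof of Prop. 1.11] -/
theorem kelvin_integral_deriv_integrand_eq_zero (hu : IsSmoothSpaceTimeOn S u)
    (hp : IsSmoothSpaceTimeOn S p) (hX : IsSmoothSpaceTimeOn S X) {γ : ℝ → E}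
    (hγ : ContDiff ℝ 1 γ) (hloop : γ 0 = γ 1) {t : ℝ} (ht : t ∈ S)
    (hint : IntervalIntegrable (fun s => ⟪u t (X t (γ s)),
        fderiv ℝ (u t) (X t (γ s)) (fderiv ℝ (X t) (γ s) (deriv γ s))⟫
      - fderiv ℝ (p t) (X t (γ s)) (fderiv ℝ (X t) (γ s) (deriv γ s))) volume 0 1) :
    ∫ s in (0 : ℝ)..1, (⟪u t (X t (γ s)),
        fderiv ℝ (u t) (X t (γ s)) (fderiv ℝ (X t) (γ s) (deriv γ s))⟫
      - fderiv ℝ (p t) (X t (γ s)) (fderiv ℝ (X t) (γ s) (deriv γ s))) = 0 := by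
  have hu1 : ∀ z, HasFDerivAt (u t) (fderiv ℝ (u t) z) z := fun z =>
    ((hu.contDiff_slice ht).differentiable (by simp) z).hasFDerivAt
  have hp1 : ∀ z, HasFDerivAt (p t) (fderiv ℝ (p t) z) z := fun z =>
    ((hp.contDiff_slice ht).differentiable (by simp) z).hasFDerivAt
  have hX1 : ∀ z, HasFDerivAt (X t) (fderiv ℝ (X t) z) z := fun z =>
    ((hX.contDiff_slice ht).differentiable (by simp) z).hasFDerivAt
  have hγ1 : ∀ s, HasDerivAt γ (deriv γ s) s := fun s => (hγ.differentiable one_ne_zero s).hasDerivAt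
  have hderiv : ∀ s ∈ uIcc (0 : ℝ) 1,
      HasDerivAt (fun s => ‖u t (X t (γ s))‖ ^ 2 / 2 - p t (X t (γ s)))
        (⟪u t (X t (γ s)), fderiv ℝ (u t) (X t (γ s)) (fderiv ℝ (X t) (γ s) (deriv γ s))⟫
          - fderiv ℝ (p t) (X t (γ s)) (fderiv ℝ (X t) (γ s) (deriv γ s))) s := by
    intro s _
    have hY : HasDerivAt (fun s => X t (γ s)) (fderiv ℝ (X t) (γ s) (deriv γ s)) s :=
      (hX1 (γ s)).comp_hasDerivAt s (hγ1 s)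
    have hU : HasDerivAt (fun s => u t (X t (γ s)))
        (fderiv ℝ (u t) (X t (γ s)) (fderiv ℝ (X t) (γ s) (deriv γ s))) s :=
      (hu1 _).comp_hasDerivAt s hY
    have hP : HasDerivAt (fun s => p t (X t (γ s)))
        (fderiv ℝ (p t) (X t (γ s)) (fderiv ℝ (X t) (γ s) (deriv γ s))) s :=
      (hp1 _).comp_hasDerivAt s hY
    refine ((hU.norm_sq.div_const 2).sub hP).congr_deriv ?_
    ring
  rw [integral_eq_sub_of_hasDerivAt hderiv hint]
  simp only [hloop, sub_self]

/-! ### Kelvin's theorem on a compact time slab, and the discharges -/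

/-- **Kelvin's circulation theorem on a compact slab** `S = [a, b]`, `a < b`: for a classical
unforced Euler solution on `[a, b] × E`, a jointly smooth particle-trajectory map `X` with
`∂ₜX = u(t, X)` within `[a, b]`, and a `C¹` loop `γ`, the circulations at the two ends agree,
`∮_{X(b, γ)} u(b) · dℓ = ∮_{X(a, γ)} u(a) · dℓ` (Majda–Bertozzi, Prop. 1.11 via Prop. 1.10: `Γ` is
continuous on `[a, b]` with `Γ′ = ∮ Dv/Dt · dℓ = −∮ ∇p · dℓ = 0` inside). [cite: MajdaBertozziCUP2002, §1.6 Prop. 1.10–1.11, eqs. (1.58)–(1.59)] -/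
theorem IsClassicalEulerSolutionOn.circulation_eq_of_Icc {a b : ℝ} (hab : a < b)
    (h : IsClassicalEulerSolutionOn (Icc a b) 0 u p) (hX : IsSmoothSpaceTimeOn (Icc a b) X)
    (hXu : ∀ t ∈ Icc a b, ∀ y, HasDerivWithinAt (fun s => X s y) (u t (X t y)) (Icc a b) t)
    {γ : ℝ → E} (hγ : ContDiff ℝ 1 γ) (hloop : γ 0 = γ 1) :
    circulation (u b) (X b ∘ γ) = circulation (u a) (X a ∘ γ) := by
  have hSU : UniqueDiffOn ℝ (Icc a b) := uniqueDiffOn_Icc hab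
  have hγc : Continuous γ := hγ.continuous
  have hγ'c : Continuous (deriv γ) := hγ.continuous_deriv le_rfl
  -- the circulation in slice form
  have hcirc : ∀ t ∈ Icc a b, circulation (u t) (X t ∘ γ) =
      ∫ s in (0 : ℝ)..1, ⟪u t (X t (γ s)), fderiv ℝ (X t) (γ s) (deriv γ s)⟫ := by
    intro t ht
    unfold circulation
    refine intervalIntegral.integral_congr fun s _ => ?_
    simp only [Function.comp_apply]
    rw [fderiv_comp_deriv s ((hX.contDiff_slice ht).differentiable (by simp) _)
      (hγ.differentiable one_ne_zero s)]
  rw [hcirc b (right_mem_Icc.2 hab.le), hcirc a (left_mem_Icc.2 hab.le)]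
  -- joint continuity of the building blocks on `[a, b] × ℝ`
  have hmaps : MapsTo (fun z : ℝ × ℝ => (z.1, γ z.2)) (Icc a b ×ˢ univ) (Icc a b ×ˢ univ) :=
    fun z hz => ⟨hz.1, mem_univ _⟩
  have hY : ContinuousOn (fun z : ℝ × ℝ => X z.1 (γ z.2)) (Icc a b ×ˢ univ) :=
    hX.continuousOn.comp (continuousOn_fst.prodMk (hγc.comp continuous_snd).continuousOn) hmaps
  have hmapsY : MapsTo (fun z : ℝ × ℝ => (z.1, X z.1 (γ z.2))) (Icc a b ×ˢ univ)
      (Icc a b ×ˢ univ) := fun z hz => ⟨hz.1, mem_univ _⟩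
  have hB : ContinuousOn (fun z : ℝ × ℝ => fderiv ℝ (X z.1) (γ z.2) (deriv γ z.2))
      (Icc a b ×ˢ univ) := by
    have h1 : ContinuousOn (fun z : ℝ × ℝ => fderiv ℝ (X z.1) (γ z.2)) (Icc a b ×ˢ univ) :=
      (hX.fderiv_slice hSU).continuousOn.comp
        (continuousOn_fst.prodMk (hγc.comp continuous_snd).continuousOn) hmaps
    exact h1.clm_apply (hγ'c.comp continuous_snd).continuousOn
  have hUY : ContinuousOn (fun z : ℝ × ℝ => u z.1 (X z.1 (γ z.2))) (Icc a b ×ˢ univ) :=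
    h.smooth_velocity.continuousOn.comp (continuousOn_fst.prodMk hY) hmapsY
  have hDU : ContinuousOn (fun z : ℝ × ℝ =>
      fderiv ℝ (u z.1) (X z.1 (γ z.2)) (fderiv ℝ (X z.1) (γ z.2) (deriv γ z.2)))
      (Icc a b ×ˢ univ) := by
    have h1 : ContinuousOn (fun z : ℝ × ℝ => fderiv ℝ (u z.1) (X z.1 (γ z.2))) (Icc a b ×ˢ univ) :=
      (h.smooth_velocity.fderiv_slice hSU).continuousOn.comp (continuousOn_fst.prodMk hY) hmapsY
    exact h1.clm_apply hB
  have hDP : ContinuousOn (fun z : ℝ × ℝ =>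
      fderiv ℝ (p z.1) (X z.1 (γ z.2)) (fderiv ℝ (X z.1) (γ z.2) (deriv γ z.2)))
      (Icc a b ×ˢ univ) := by
    have h1 : ContinuousOn (fun z : ℝ × ℝ => fderiv ℝ (p z.1) (X z.1 (γ z.2))) (Icc a b ×ˢ univ) :=
      (h.smooth_pressure.fderiv_slice hSU).continuousOn.comp (continuousOn_fst.prodMk hY) hmapsY
    exact h1.clm_apply hB
  -- the real-variable lemma
  refine intervalIntegral_eq_of_hasDerivAt_of_integral_eq_zero
    (F := fun τ s => ⟪u τ (X τ (γ s)), fderiv ℝ (X τ) (γ s) (deriv γ s)⟫)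
    (F' := fun τ s => ⟪u τ (X τ (γ s)), fderiv ℝ (u τ) (X τ (γ s)) (fderiv ℝ (X τ) (γ s) (deriv γ s))⟫
      - fderiv ℝ (p τ) (X τ (γ s)) (fderiv ℝ (X τ) (γ s) (deriv γ s)))
    hab (hUY.inner hB) ((hUY.inner hDU).sub hDP) (fun t ht s => ?_) (fun t ht hint => ?_)
  · exact h.hasDerivAt_circulation_integrand hX hXu (Icc_mem_nhds ht.1 ht.2) (γ s) (deriv γ s)
  · exact kelvin_integral_deriv_integrand_eq_zero h.smooth_velocity h.smooth_pressure hX hγ hloop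
      (Ioo_subset_Icc_self ht) hint

/-- **Discharge of `IsClassicalEulerSolutionOn.circulation_eq`** (Kelvin's circulation theorem,
Majda–Bertozzi 2002, §1.6 **Prop. 1.11**, eq. (1.59), via the transport formula Prop. 1.10,
eq. (1.58)): for a smooth unforced Euler solution on `E × S`, `S` convex, a jointly smooth
particle-trajectory map `X` with `∂ₜX = u(t, X)` within `S` and a closed `C¹` loop `γ`, the
circulation `∮_{X(t, γ)} u(t) · dℓ` is independent of `t ∈ S`. Reduction to a compact slab
`[t₀, t₁] ⊆ S` (convexity; `IsClassicalNSSolutionOn.mono`) and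
`IsClassicalEulerSolutionOn.circulation_eq_of_Icc`. [cite: MajdaBertozziCUP2002, §1.6 Prop. 1.11, eq. (1.59)] -/
theorem IsClassicalEulerSolutionOn.circulation_eq_holds :
    IsClassicalEulerSolutionOn.circulation_eq (E := E) (S := S) (u := u) (p := p) := by
  intro h hS X hX hXu γ hγ hloop t₀ t₁ ht₀ ht₁
  have key : ∀ ⦃a b : ℝ⦄, a ∈ S → b ∈ S → a < b →
      circulation (u b) (X b ∘ γ) = circulation (u a) (X a ∘ γ) := by
    intro a b ha hb hab
    have hsub : Icc a b ⊆ S := hS.ordConnected.out ha hb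
    exact IsClassicalEulerSolutionOn.circulation_eq_of_Icc hab (h.mono hsub (uniqueDiffOn_Icc hab))
      (hX.mono hsub) (fun t ht y => (hXu t (hsub ht) y).mono hsub) hγ hloop
  rcases lt_trichotomy t₀ t₁ with hlt | heq | hgt
  · exact key ht₀ ht₁ hlt
  · subst heq; rfl
  · exact (key ht₁ ht₀ hgt).symm

/-- **Discharge of `kelvin_circulation_theorem`** (**ns.S34**, Kelvin's circulation theorem;
Majda–Bertozzi 2002, §1.6 **Prop. 1.11**, eq. (1.59), obtained from the transport formula for
material curves Prop. 1.10, eq. (1.58), the Euler equation (1.62) and the vanishing of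
`∮ ∇p · dℓ` on closed curves): the named fact of `NSVorticity.lean` is the same statement as
`IsClassicalEulerSolutionOn.circulation_eq`, discharged above. [cite: MajdaBertozziCUP2002, §1.6 Prop. 1.11, eq. (1.59)] -/
theorem kelvin_circulation_theorem_holds :
    kelvin_circulation_theorem (E := E) (S := S) (u := u) (p := p) :=
  IsClassicalEulerSolutionOn.circulation_eq_holds

end Kelvin

end Literature.Analysis.FluidPDE

end
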